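import Literature.Topology.FourManifolds.WhiteheadStage
import Literature.Topology.FourManifolds.PLManifold
import HarnessLib

/-!
# Whitehead's triangulation theorem: existence (Munkres 1966, Theorem 10.6)

Four parts (merged into one module to shorten the landing chain; each part was developed and
checked separately):

* **The cover by pieces** (`exists_cover_pieces`): a sequence of cover pieces indexed by `ℕ` (with gaps)
  whose open innermost boxes cover the manifold, each meeting only finitely many others — from a
  compact exhaustion, its shells and finitely many small chart cubes per shell.
* **The induction** (`seq`): the states after `k` stages along the pieces, with: the cores cover
  the processed pieces (`pieces_subset`), birth regions never change (`D_stable`), every chart's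
  data is eventually constant (`chart_eventually_const`), every point eventually lies in a fixed
  core forever (`point_eventually_core`).
* **Local tools**: star subcomplexes (`starCx`), purity of the lattice refinement
  (`latticeRefinement_pure`), images of relatively open sets (`isOpen_inter_image_of_isOpen`),
  globalisation of smooth maps near compact sets (`exists_contDiff_eqOn_of_isCompact`), the local
  image complex of a state at a point (`exists_local_image_complex`), and its two consequences:
  the chart transitions are PL (`local_pl`) and the transitions to the smooth charts are piecewise
  smooth of maximal rank (`local_pd`).
* **The theorem**: the limit charts (`finalChart`), the PL charted space (`plCharted`), its PL
  compatibility (`isPLManifold_plCharted`) and Whitehead compatibility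
  (`isWhiteheadCompatible_plCharted`), the empty case, and
  `exists_isPLManifold_isWhiteheadCompatible_holds`.

No named facts are introduced (`GoodState` is a bookkeeping structure).
-/

open Set Function Metric Filter
open scoped Topology NNReal Manifold ContDiff

noncomputable section

-- `[T2Space M]` is a section variable used by most lemmas below; per-lemma `omit` would be noise.
set_option linter.unusedSectionVars false

namespace Literature.Topology.FourManifolds

open Literature.Analysis.Convexity

local notation "𝔼 " n:arg => EuclideanSpace ℝ (Fin n)

/-! ## Part A: the cover by pieces -/

section Cubes

variable {n : ℕ}

/-- The cube of half-width `s` about `c`. [folklore] -/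
def cube (c : 𝔼 n) (s : ℝ) : Set (𝔼 n) := box (fun i => c i - s) (fun i => c i + s)

/-- A cube lies in the closed ball of radius `s * (√n + 1)`. [folklore] -/
theorem cube_subset_closedBall (c : 𝔼 n) {s : ℝ} (hs : 0 ≤ s) : cube c s ⊆ closedBall c (s * (Real.sqrt n + 1)) := by
  intro x hx
  rw [mem_closedBall, dist_eq_norm, EuclideanSpace.norm_eq]
  have hcoord : ∀ i, ‖(x - c) i‖ ^ 2 ≤ s ^ 2 := fun i => by
    have h := hx i
    simp only [PiLp.sub_apply, Real.norm_eq_abs, sq_abs]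
    have : |x i - c i| ≤ s := abs_le.2 ⟨by linarith [h.1], by linarith [h.2]⟩
    nlinarith [abs_nonneg (x i - c i), sq_abs (x i - c i)]
  calc Real.sqrt (∑ i, ‖(x - c) i‖ ^ 2) ≤ Real.sqrt (∑ _i : Fin n, s ^ 2) :=
        Real.sqrt_le_sqrt (Finset.sum_le_sum fun i _ => hcoord i)
    _ = Real.sqrt n * s := by
        rw [Finset.sum_const, Finset.card_univ, Fintype.card_fin, nsmul_eq_mul, Real.sqrt_mul' _ (sq_nonneg s),
          Real.sqrt_sq hs]
    _ ≤ s * (Real.sqrt n + 1) := by nlinarith [Real.sqrt_nonneg n]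

/-- The centre lies in the open cube. [folklore] -/
theorem mem_openCube (c : 𝔼 n) {s : ℝ} (hs : 0 < s) : c ∈ openBox (fun i => c i - s) (fun i => c i + s) :=
  fun i => ⟨by linarith, by linarith⟩

/-- **A piece about a point inside a prescribed open set.** [folklore] -/
theorem exists_piece {M : Type*} [TopologicalSpace M] [ChartedSpace (EuclideanSpace ℝ (Fin n)) M]
    (p : M) {O : Set M} (hO : IsOpen O) (hp : p ∈ O) :
    ∃ P : Piece n M, p ∈ P.e.symm '' openBox (P.a 0) (P.b 0) ∧ P.e.symm '' P.B 7 ⊆ O := by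
  set e := chartAt (EuclideanSpace ℝ (Fin n)) p with he
  have hps : p ∈ e.source := mem_chart_source _ p
  -- an open set of the chart space around `e p`, inside the target and over `O`
  have hV : IsOpen (e.target ∩ e.symm ⁻¹' O) := e.isOpen_inter_preimage_symm hO
  have hpV : e p ∈ e.target ∩ e.symm ⁻¹' O := ⟨e.map_source hps, by show e.symm (e p) ∈ O; rw [e.left_inv hps]; exact hp⟩
  obtain ⟨r, hr, hball⟩ := Metric.isOpen_iff.1 hV (e p) hpV
  -- eight nested cubes of half-widths `(ℓ + 1) s`, `s = r / (16 (√n + 1))`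
  set s : ℝ := r / (16 * (Real.sqrt n + 1)) with hs
  have hs0 : 0 < s := by rw [hs]; positivity
  set w : Fin 8 → ℝ := fun ℓ => ((ℓ : ℕ) : ℝ) + 1 with hw
  have hw0 : ∀ ℓ, 0 < w ℓ := fun ℓ => by rw [hw]; positivity
  have hwle : ∀ ℓ, w ℓ ≤ 8 := fun ℓ => by
    rw [hw]; have := ℓ.2; simp only
    have : ((ℓ : ℕ) : ℝ) ≤ 7 := by exact_mod_cast Nat.lt_succ_iff.1 ℓ.2
    linarith
  have hwsucc : ∀ ℓ : Fin 7, w ℓ.succ = w ℓ.castSucc + 1 := fun ℓ => by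
    simp only [hw, Fin.val_succ, Fin.val_castSucc]; push_cast; ring
  set a : Fin 8 → Fin n → ℝ := fun ℓ i => e p i - w ℓ * s with ha
  set b : Fin 8 → Fin n → ℝ := fun ℓ i => e p i + w ℓ * s with hb
  have hab : ∀ ℓ i, a ℓ i < b ℓ i := fun ℓ i => by
    have := mul_pos (hw0 ℓ) hs0
    simp only [ha, hb]; linarith
  have hnest : ∀ ℓ : Fin 7, cthickening s (box (a ℓ.castSucc) (b ℓ.castSucc)) ⊆ box (a ℓ.succ) (b ℓ.succ) := fun ℓ => by
    refine cthickening_box_subset hs0.le (fun i => ?_) (fun i => ?_)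
    · simp only [ha, hwsucc]; linarith
    · simp only [hb, hwsucc]; linarith
  -- every cube lies in the `r`-ball about `e p`
  have hcube : ∀ ℓ, box (a ℓ) (b ℓ) ⊆ ball (e p) r := fun ℓ x hx => by
    have hx' : x ∈ cube (e p) (8 * s) := fun i => by
      have h := hx i
      have h8 := mul_le_mul_of_nonneg_right (hwle ℓ) hs0.le
      simp only [ha, hb] at h
      constructor <;> linarith [h.1, h.2]
    have h2 := cube_subset_closedBall (e p) (by positivity : (0 : ℝ) ≤ 8 * s) hx'
    rw [mem_ball]
    refine lt_of_le_of_lt (mem_closedBall.1 h2) ?_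
    rw [hs]
    have hpos : 0 < Real.sqrt n + 1 := by positivity
    field_simp
    nlinarith
  refine ⟨⟨e, chart_mem_atlas _ p, a, b, hab, s, hs0, hnest, fun x hx => (hball (hcube 7 hx)).1⟩, ?_, ?_⟩
  · refine ⟨e p, fun i => ?_, e.left_inv hps⟩
    have := mul_pos (hw0 0) hs0
    show e p i - w 0 * s < e p i ∧ e p i < e p i + w 0 * s
    constructor <;> linarith
  · rintro _ ⟨x, hx, rfl⟩
    exact (hball (hcube 7 hx)).2

end Cubes

section Cover

variable {n : ℕ} {M : Type*} [TopologicalSpace M] [T2Space M] [SecondCountableTopology M]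
  [ChartedSpace (EuclideanSpace ℝ (Fin n)) M]

/-- **The cover by pieces.** There is a sequence of pieces (with gaps) whose open innermost boxes
cover `M`, each piece meeting (through the largest boxes) only finitely many others. [folklore] -/
theorem exists_cover_pieces : ∃ pc : ℕ → Option (Piece n M),
    (∀ p : M, ∃ k, ∃ P : Piece n M, pc k = some P ∧ p ∈ P.e.symm '' openBox (P.a 0) (P.b 0)) ∧
    ∀ k (P : Piece n M), pc k = some P →
      {k' | ∃ P' : Piece n M, pc k' = some P' ∧ (P'.e.symm '' P'.B 7 ∩ P.e.symm '' P.B 7).Nonempty}.Finite := by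
  classical
  haveI : LocallyCompactSpace M := ChartedSpace.locallyCompactSpace (EuclideanSpace ℝ (Fin n)) M
  -- a compact exhaustion with `K 0 = ∅`
  set K : CompactExhaustion M := (CompactExhaustion.choice M).shiftr with hK
  have hK0 : K 0 = ∅ := rfl
  -- shells and their open neighbourhoods
  set Sh : ℕ → Set M := fun i => K (i + 1) \ interior (K i) with hSh
  set O : ℕ → Set M := fun i => interior (K (i + 2)) \ K (i - 1) with hO
  have hShc : ∀ i, IsCompact (Sh i) := fun i => (K.isCompact (i + 1)).diff isOpen_interior
  have hOo : ∀ i, IsOpen (O i) := fun i => isOpen_interior.sdiff (K.isCompact _).isClosed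
  have hShO : ∀ i, Sh i ⊆ O i := fun i p hp => by
    refine ⟨K.subset_interior_succ (i + 1) hp.1, fun hp' => hp.2 ?_⟩
    rcases Nat.eq_zero_or_pos i with rfl | hi
    · simp [hK0] at hp'
    · have h := K.subset_interior_succ (i - 1) hp'
      rwa [Nat.sub_add_cancel hi] at h
  have hOdisj : ∀ i i', i + 3 ≤ i' → Disjoint (O i) (O i') := fun i i' h => by
    rw [Set.disjoint_left]
    rintro p ⟨hp1, -⟩ ⟨-, hp2⟩
    apply hp2
    have hle : i + 2 ≤ i' - 1 := by omega
    exact K.subset hle (interior_subset hp1)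
  -- finitely many pieces per shell, as a list
  have hcov : ∀ i, ∃ L : List (Piece n M), (∀ P ∈ L, P.e.symm '' P.B 7 ⊆ O i) ∧
      Sh i ⊆ ⋃ P ∈ L, P.e.symm '' openBox (P.a 0) (P.b 0) := fun i => by
    have hch : ∀ p : ↥(Sh i), ∃ P : Piece n M, (p : M) ∈ P.e.symm '' openBox (P.a 0) (P.b 0) ∧ P.e.symm '' P.B 7 ⊆ O i :=
      fun p => exists_piece (p : M) (hOo i) (hShO i p.2)
    choose Pc hPc1 hPc2 using hch
    have hopen : ∀ p : ↥(Sh i), IsOpen ((Pc p).e.symm '' openBox ((Pc p).a 0) ((Pc p).b 0)) := fun p =>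
      (Pc p).e.symm.isOpen_image_of_subset_source (isOpen_openBox _ _)
        (by rw [(Pc p).e.symm_source]; exact (openBox_subset_box _ _).trans ((Pc p).B_subset_target 0))
    obtain ⟨T, hTcov⟩ := (hShc i).elim_finite_subcover (fun p : ↥(Sh i) => (Pc p).e.symm '' openBox ((Pc p).a 0) ((Pc p).b 0))
      hopen (fun p hp => mem_iUnion.2 ⟨⟨p, hp⟩, hPc1 ⟨p, hp⟩⟩)
    refine ⟨T.toList.map Pc, fun P hP => ?_, fun q hq => ?_⟩
    · obtain ⟨p, -, rfl⟩ := List.mem_map.1 hP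
      exact hPc2 p
    · obtain ⟨p, hp, hqp⟩ := mem_iUnion₂.1 (hTcov hq)
      exact mem_iUnion₂.2 ⟨Pc p, List.mem_map.2 ⟨p, Finset.mem_toList.2 hp, rfl⟩, hqp⟩
  choose L hL1 hL2 using hcov
  -- the sequence of pieces
  refine ⟨fun k => (L (Nat.unpair k).1)[(Nat.unpair k).2]?, fun p => ?_, fun k P hkP => ?_⟩
  · -- coverage: `p` lies in the shell `find p - 1`
    have hfind : 1 ≤ K.find p := by
      by_contra h
      have h0 : K.find p = 0 := by omega
      have := K.mem_find p
      rw [h0, hK0] at this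
      exact this
    have hpSh : p ∈ Sh (K.find p - 1) := by
      refine ⟨by rw [Nat.sub_add_cancel hfind]; exact K.mem_find p, fun hp => ?_⟩
      have h1 : p ∈ K (K.find p - 1) := interior_subset hp
      have h2 := (K.mem_iff_find_le).1 h1
      omega
    obtain ⟨P, hPL, hpP⟩ := mem_iUnion₂.1 (hL2 _ hpSh)
    obtain ⟨m, hm⟩ := List.mem_iff_getElem?.1 hPL
    refine ⟨Nat.pair (K.find p - 1) m, P, ?_, hpP⟩
    simp only [Nat.unpair_pair]
    exact hm
  · -- local finiteness
    set i := (Nat.unpair k).1 with hi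
    have hPL : P ∈ L i := List.mem_of_getElem? hkP
    have hPO : P.e.symm '' P.B 7 ⊆ O i := hL1 i P hPL
    have hsub : {k' | ∃ P' : Piece n M, (L (Nat.unpair k').1)[(Nat.unpair k').2]? = some P' ∧
        (P'.e.symm '' P'.B 7 ∩ P.e.symm '' P.B 7).Nonempty} ⊆
        ⋃ i' ∈ Finset.range (i + 3), (fun m' => Nat.pair i' m') '' ↑(Finset.range (L i').length) := by
      rintro k' ⟨P', hk'P', hmeet⟩
      set i' := (Nat.unpair k').1 with hi'
      set m' := (Nat.unpair k').2 with hm'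
      have hP'L : P' ∈ L i' := List.mem_of_getElem? hk'P'
      have hP'O : P'.e.symm '' P'.B 7 ⊆ O i' := hL1 i' P' hP'L
      have hOO : (O i ∩ O i').Nonempty := by
        obtain ⟨q, hq1, hq2⟩ := hmeet
        exact ⟨q, hPO hq2, hP'O hq1⟩
      have hi'le : i' < i + 3 := by
        by_contra h
        have hd := hOdisj i i' (by omega)
        rw [Set.disjoint_iff_inter_eq_empty] at hd
        rw [hd] at hOO; exact Set.not_nonempty_empty hOO
      have hm'lt : m' < (L i').length := by
        rcases lt_or_ge m' (L i').length with h | h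
        · exact h
        · rw [List.getElem?_eq_none_iff.2 h] at hk'P'; exact absurd hk'P' (by simp)
      refine mem_iUnion₂.2 ⟨i', Finset.mem_range.2 hi'le, m', Finset.mem_coe.2 (Finset.mem_range.2 hm'lt), ?_⟩
      show Nat.pair i' m' = k'
      rw [hi', hm', Nat.pair_unpair]
    exact ((Finset.range (i + 3)).finite_toSet.biUnion fun i' _ => (Finset.finite_toSet _).image _).subset hsub

end Cover


/-! ## Part B: the induction -/

section Induction

variable {n : ℕ} {M : Type*} [TopologicalSpace M] [T2Space M] [ChartedSpace (EuclideanSpace ℝ (Fin n)) M]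
  [IsManifold (𝓡 n) ∞ M]

/-- **GoodState states**: a state with all chart invariants and no charts born at or after `k`.
(Bookkeeping structure.) [folklore] -/
structure GoodState (n : ℕ) (M : Type*) [TopologicalSpace M] [ChartedSpace (EuclideanSpace ℝ (Fin n)) M] (k : ℕ) where
  /-- the state -/
  st : TriState n M
  inv : ∀ j, ChartInv st j
  unborn : ∀ j, k ≤ j → st.W j = ∅ ∧ st.C' j = ∅ ∧ st.D j = ∅

/-- The empty state (no simplices, no charts). [folklore] -/
def emptyState [Nonempty M] : TriState n M where
  N := 0
  K := ⊥
  hK := by intro s hs; rw [Geometry.SimplicialComplex.faces_bot] at hs; exact hs.elim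
  pure := by intro s hs; rw [Geometry.SimplicialComplex.faces_bot] at hs; exact hs.elim
  f := fun _ => Classical.arbitrary M
  inj := by rw [Geometry.SimplicialComplex.space_bot]; exact injOn_empty _
  cont := by intro s hs; rw [Geometry.SimplicialComplex.faces_bot] at hs; exact hs.elim
  model := by intro s hs; rw [Geometry.SimplicialComplex.faces_bot] at hs; exact hs.elim
  D := fun _ => ∅
  W := fun _ => ∅
  φ := fun _ _ => 0
  C' := fun _ => ∅

/-- The empty good state. [folklore] -/
def good₀ [Nonempty M] : GoodState n M 0 where
  st := emptyState
  inv := fun j => chartInv_empty _ j rfl rfl rfl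
  unborn := fun _ _ => ⟨rfl, rfl, rfl⟩

variable (pc : ℕ → Option (Piece n M))

/-- **One step of the induction**: run the stage of the `k`-th piece (if any). [folklore] -/
def stageStep (k : ℕ) (G : GoodState n M k) : GoodState n M (k + 1) :=
  match pc k with
  | none => ⟨G.st, G.inv, fun j hj => G.unborn j (Nat.le_of_succ_le hj)⟩
  | some P => ⟨next G.st P k (fun j _ => G.inv j),
      chartInv_next G.st P k (fun j _ => G.inv j) (fun j hj => G.unborn j hj.le),
      fun j hj => next_unborn G.st P k (fun j _ => G.inv j) j hj⟩

/-- **The sequence of good states.** [folklore] -/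
def seq [Nonempty M] : (k : ℕ) → GoodState n M k
  | 0 => good₀
  | k + 1 => stageStep pc k (seq k)

variable [Nonempty M]

/-- Auxiliary (`seq_succ`). [folklore] -/
theorem seq_succ (k : ℕ) : seq pc (k + 1) = stageStep pc k (seq pc k) := rfl

/-- Auxiliary (`step_none`). [folklore] -/
theorem step_none {k : ℕ} (hk : pc k = none) (G : GoodState n M k) : (stageStep pc k G).st = G.st := by
  simp [stageStep, hk]

/-- Auxiliary (`step_some`). [folklore] -/
theorem step_some {k : ℕ} {P : Piece n M} (hk : pc k = some P) (G : GoodState n M k) :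
    (stageStep pc k G).st = next G.st P k (fun j _ => G.inv j) := by
  simp [stageStep, hk]

/-! ### Coverage of the processed pieces -/

/-- **The cores cover the processed pieces.** [folklore] -/
theorem pieces_subset (k : ℕ) : ∀ k' < k, ∀ P : Piece n M, pc k' = some P →
    P.Cpiece ⊆ ⋃ j, (seq pc k).st.C' j := by
  induction k with
  | zero => intro k' hk'; exact absurd hk' (Nat.not_lt_zero _)
  | succ k ih =>
    intro k' hk' P hP
    -- the union of cores only grows, and gains the piece of stage `k`
    have hmono : (⋃ j, (seq pc k).st.C' j) ∪ (match pc k with | none => ∅ | some Q => Q.Cpiece) ⊆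
        ⋃ j, (seq pc (k + 1)).st.C' j := by
      rw [seq_succ]
      cases hpk : pc k with
      | none => rw [step_none pc hpk]; simp
      | some Q =>
        rw [step_some pc hpk]
        simp only
        exact cores_next (seq pc k).st Q k (fun j _ => (seq pc k).inv j) (fun j hj => ((seq pc k).unborn j hj).2.1)
    rcases (Nat.lt_succ_iff_lt_or_eq.1 hk') with hlt | rfl
    · exact (ih k' hlt P hP).trans (subset_union_left.trans hmono)
    · have : (match pc k' with | none => ∅ | some Q => Q.Cpiece) = P.Cpiece := by rw [hP]
      rw [this] at hmono
      exact subset_union_right.trans hmono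

/-! ### Birth regions -/

/-- The birth region of chart `j` at stage `k > j` is that at stage `j + 1`. [folklore] -/
theorem D_stable (j : ℕ) : ∀ k, j < k → (seq pc k).st.D j = (seq pc (j + 1)).st.D j := by
  intro k hk
  induction k with
  | zero => exact absurd hk (Nat.not_lt_zero _)
  | succ k ih =>
    rcases (Nat.lt_succ_iff_lt_or_eq.1 hk) with hlt | rfl
    · rw [← ih hlt, seq_succ]
      cases hpk : pc k with
      | none => rw [step_none pc hpk]
      | some Q =>
        rw [step_some pc hpk]
        exact next_D_le _ Q k _ hlt
    · rfl

/-- The birth region of chart `j` lies in the region of the `j`-th piece (empty if none).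
[folklore] -/
theorem D_subset (j : ℕ) :
    (seq pc (j + 1)).st.D j ⊆ (match pc j with | none => ∅ | some Q => Q.e.symm '' Q.B 7) := by
  rw [seq_succ]
  cases hpj : pc j with
  | none =>
    rw [step_none pc hpj]
    intro x hx
    rw [((seq pc j).unborn j le_rfl).2.2] at hx
    exact hx.elim
  | some Q =>
    rw [step_some pc hpj]
    exact next_D_new_subset _ Q j _

/-! ### Eventual constancy of the chart data -/

/-- A stage whose piece avoids the birth region of chart `j` leaves its data untouched.
[folklore] -/
theorem data_succ_of_disjoint {j k : ℕ} (hjk : j < k)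
    (hdisj : ∀ Q : Piece n M, pc k = some Q → (seq pc (j + 1)).st.D j ∩ Q.e.symm '' Q.B 7 = ∅) :
    (seq pc (k + 1)).st.W j = (seq pc k).st.W j ∧ (seq pc (k + 1)).st.φ j = (seq pc k).st.φ j ∧
      (seq pc (k + 1)).st.C' j = (seq pc k).st.C' j := by
  rw [seq_succ]
  cases hpk : pc k with
  | none => rw [step_none pc hpk]; exact ⟨rfl, rfl, rfl⟩
  | some Q =>
    rw [step_some pc hpk]
    have hu : Untouched (seq pc k).st Q j := ⟨by
      rw [D_stable pc j k hjk]
      exact hdisj Q hpk⟩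
    obtain ⟨h1, h2, h3, -⟩ := next_untouched (seq pc k).st Q k (fun j _ => (seq pc k).inv j) hjk hu
    exact ⟨h1, h2, h3⟩

/-- **Every chart's data is eventually constant**, given local finiteness of the pieces.
[folklore] -/
theorem chart_eventually_const
    (hfin : ∀ k (P : Piece n M), pc k = some P →
      {k' | ∃ P' : Piece n M, pc k' = some P' ∧ (P'.e.symm '' P'.B 7 ∩ P.e.symm '' P.B 7).Nonempty}.Finite)
    (j : ℕ) : ∃ k₀, j < k₀ ∧ ∀ k, k₀ ≤ k →
      (seq pc k).st.W j = (seq pc k₀).st.W j ∧ (seq pc k).st.φ j = (seq pc k₀).st.φ j ∧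
      (seq pc k).st.C' j = (seq pc k₀).st.C' j := by
  -- the stages that can touch chart `j`
  have hT : {k | ∃ Q : Piece n M, pc k = some Q ∧ ((seq pc (j + 1)).st.D j ∩ Q.e.symm '' Q.B 7).Nonempty}.Finite := by
    cases hpj : pc j with
    | none =>
      have hD : (seq pc (j + 1)).st.D j = ∅ := by
        have h := D_subset pc j; rw [hpj] at h; exact subset_empty_iff.1 h
      convert Set.finite_empty
      ext k
      simp only [mem_setOf_eq, mem_empty_iff_false, iff_false, not_exists, not_and]
      intro Q _ hne
      rw [hD, empty_inter] at hne
      exact Set.not_nonempty_empty hne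
    | some P =>
      refine (hfin j P hpj).subset ?_
      rintro k ⟨Q, hQ, hne⟩
      have hD := D_subset pc j
      rw [hpj] at hD
      obtain ⟨q, hq1, hq2⟩ := hne
      exact ⟨Q, hQ, q, hq2, hD hq1⟩
  obtain ⟨k₀, hk₀⟩ := hT.bddAbove
  refine ⟨max k₀ j + 1, by omega, fun k hk => ?_⟩
  induction k with
  | zero => exact absurd hk (by omega)
  | succ k ih =>
    rcases (Nat.lt_or_ge k (max k₀ j + 1)) with hlt | hge
    · have : k + 1 = max k₀ j + 1 := by omega
      rw [this]; exact ⟨rfl, rfl, rfl⟩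
    · obtain ⟨h1, h2, h3⟩ := ih hge
      have hjk : j < k := by omega
      have hdisj : ∀ Q : Piece n M, pc k = some Q → (seq pc (j + 1)).st.D j ∩ Q.e.symm '' Q.B 7 = ∅ := fun Q hQ => by
        by_contra hne
        have hk' : k ∈ {k | ∃ Q : Piece n M, pc k = some Q ∧ ((seq pc (j + 1)).st.D j ∩ Q.e.symm '' Q.B 7).Nonempty} :=
          ⟨Q, hQ, nonempty_iff_ne_empty.2 hne⟩
        have := hk₀ hk'
        omega
      obtain ⟨e1, e2, e3⟩ := data_succ_of_disjoint pc hjk hdisj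
      exact ⟨e1.trans h1, e2.trans h2, e3.trans h3⟩

/-! ### Every point eventually lies in a fixed core -/

/-- A point of a core which is not in the open core box of the stage's piece stays in that core.
[folklore] -/
theorem core_succ {j k : ℕ} (hjk : j < k) {p : M} (hp : p ∈ (seq pc k).st.C' j)
    (hnot : ∀ Q : Piece n M, pc k = some Q → p ∉ Q.e.symm '' Q.B 7) : p ∈ (seq pc (k + 1)).st.C' j := by
  rw [seq_succ]
  cases hpk : pc k with
  | none => rw [step_none pc hpk]; exact hp
  | some Q =>
    rw [step_some pc hpk]
    by_cases hu : Untouched (seq pc k).st Q j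
    · rw [(next_untouched (seq pc k).st Q k (fun j _ => (seq pc k).inv j) hjk hu).2.2.1]; exact hp
    · rw [(next_touched (seq pc k).st Q k (fun j _ => (seq pc k).inv j) hjk hu).2.2.1]
      refine ⟨hp, fun hp2 => hnot Q hpk ?_⟩
      obtain ⟨z, hz, rfl⟩ := hp2
      exact ⟨z, Q.B_mono (by decide) (openBox_subset_box _ _ hz), rfl⟩

/-- Cores are born before their stage: `p ∈ C' j` at stage `k` forces `j < k`. [folklore] -/
theorem lt_of_mem_core {j k : ℕ} {p : M} (hp : p ∈ (seq pc k).st.C' j) : j < k := by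
  by_contra h
  rw [((seq pc k).unborn j (not_lt.1 h)).2.1] at hp
  exact hp

/-- **Every point eventually lies in a fixed core**, given coverage and local finiteness of the
pieces. [folklore] -/
theorem point_eventually_core
    (hcov : ∀ p : M, ∃ k, ∃ P : Piece n M, pc k = some P ∧ p ∈ P.e.symm '' openBox (P.a 0) (P.b 0))
    (hfin : ∀ k (P : Piece n M), pc k = some P →
      {k' | ∃ P' : Piece n M, pc k' = some P' ∧ (P'.e.symm '' P'.B 7 ∩ P.e.symm '' P.B 7).Nonempty}.Finite)
    (p : M) : ∃ j k₁, ∀ k, k₁ ≤ k → p ∈ (seq pc k).st.C' j := by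
  obtain ⟨kp, P, hP, hpP⟩ := hcov p
  have hpC : p ∈ P.Cpiece := by
    obtain ⟨z, hz, rfl⟩ := hpP; exact ⟨z, openBox_subset_box _ _ hz, rfl⟩
  have hp7 : p ∈ P.e.symm '' P.B 7 := by
    obtain ⟨z, hz, rfl⟩ := hpC; exact ⟨z, P.B_mono (by decide) hz, rfl⟩
  -- the stages whose pieces contain `p` in their region are finitely many
  obtain ⟨K₀, hK₀⟩ := (hfin kp P hP).bddAbove
  set k₁ := max K₀ kp + 1 with hk₁
  obtain ⟨j, hpj⟩ := mem_iUnion.1 (pieces_subset pc k₁ kp (by omega) P hP hpC)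
  refine ⟨j, k₁, fun k hk => ?_⟩
  induction k with
  | zero => exact absurd hk (by omega)
  | succ k ih =>
    rcases (Nat.lt_or_ge k k₁) with hlt | hge
    · have : k + 1 = k₁ := by omega
      rw [this]; exact hpj
    · have hpk := ih hge
      refine core_succ pc (lt_of_mem_core pc hpk) hpk fun Q hQ hpQ => ?_
      have hmem : k ∈ {k' | ∃ P' : Piece n M, pc k' = some P' ∧ (P'.e.symm '' P'.B 7 ∩ P.e.symm '' P.B 7).Nonempty} :=
        ⟨Q, hQ, p, hpQ, hp7⟩
      have := hK₀ hmem
      omega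

end Induction


/-! ## Part C: local tools -/

/-! ### Stars -/

section Star

variable {W : Type*} [NormedAddCommGroup W] [NormedSpace ℝ W] {K : Geometry.SimplicialComplex ℝ W}

/-- **The open star neighbourhood.** In a finite complex, a point `x₀` of the underlying space
has an open neighbourhood which meets the underlying space only inside closed simplices
containing `x₀`. [folklore] -/
theorem exists_star_open (hfin : K.faces.Finite) (x₀ : W) :
    ∃ U : Set W, IsOpen U ∧ x₀ ∈ U ∧ ∀ x ∈ K.space ∩ U, ∃ t ∈ K.faces,
      x₀ ∈ convexHull ℝ (t : Set W) ∧ x ∈ convexHull ℝ (t : Set W) := by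
  -- the union of the closed simplices not containing `x₀` is closed and misses `x₀`
  set C : Set W := ⋃ s ∈ {s ∈ K.faces | x₀ ∉ convexHull ℝ (s : Set W)}, convexHull ℝ (s : Set W) with hC
  have hCc : IsClosed C := by
    refine (hfin.subset (fun s hs => hs.1)).isClosed_biUnion fun s _ => ?_
    exact (s.finite_toSet.isCompact_convexHull (𝕜 := ℝ)).isClosed
  have hx₀C : x₀ ∉ C := fun h => by
    obtain ⟨s, hs, hxs⟩ := mem_iUnion₂.1 h
    exact hs.2 hxs
  refine ⟨Cᶜ, hCc.isOpen_compl, hx₀C, fun x hx => ?_⟩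
  obtain ⟨s, hs, hxs⟩ := Geometry.SimplicialComplex.mem_space_iff.1 hx.1
  by_cases h0 : x₀ ∈ convexHull ℝ (s : Set W)
  · exact ⟨s, hs, h0, hxs⟩
  · exact (hx.2 (mem_iUnion₂.2 ⟨s, ⟨hs, h0⟩, hxs⟩)).elim

/-- The faces of the star of `x₀`: simplices with a coface whose closed simplex contains `x₀`.
[folklore] -/
def starFaces (K : Geometry.SimplicialComplex ℝ W) (x₀ : W) : Set (Finset W) :=
  {t | t ∈ K.faces ∧ ∃ t' ∈ K.faces, t ⊆ t' ∧ x₀ ∈ convexHull ℝ (t' : Set W)}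

/-- Auxiliary (`starFaces_subset`). [folklore] -/
theorem starFaces_subset (x₀ : W) : starFaces K x₀ ⊆ K.faces := fun _ h => h.1

/-- Auxiliary (`starFaces_down`). [folklore] -/
theorem starFaces_down (x₀ : W) : ∀ t ∈ starFaces K x₀, ∀ r ⊆ t, r.Nonempty → r ∈ starFaces K x₀ :=
  fun _ ht _ hr hne => ⟨K.down_closed ht.1 hr hne, ht.2.imp fun _ h => ⟨h.1, hr.trans h.2.1, h.2.2⟩⟩

/-- **The star subcomplex** of `x₀`. [folklore] -/
def starCx (K : Geometry.SimplicialComplex ℝ W) (x₀ : W) : Geometry.SimplicialComplex ℝ W :=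
  subcomplexOf K (starFaces K x₀) (starFaces_subset x₀) (starFaces_down x₀)

/-- Auxiliary (`mem_starCx_faces`). [folklore] -/
theorem mem_starCx_faces {x₀ : W} {t : Finset W} :
    t ∈ (starCx K x₀).faces ↔ t ∈ K.faces ∧ ∃ t' ∈ K.faces, t ⊆ t' ∧ x₀ ∈ convexHull ℝ (t' : Set W) := Iff.rfl

/-- Auxiliary (`starCx_finite`). [folklore] -/
theorem starCx_finite (hfin : K.faces.Finite) (x₀ : W) : (starCx K x₀).faces.Finite := hfin.subset (starFaces_subset x₀)

/-- The star covers the open star neighbourhood. [folklore] -/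
theorem starCx_space_supset (hfin : K.faces.Finite) (x₀ : W) :
    ∃ U : Set W, IsOpen U ∧ x₀ ∈ U ∧ K.space ∩ U ⊆ (starCx K x₀).space := by
  obtain ⟨U, hU, hxU, hstar⟩ := exists_star_open hfin x₀
  refine ⟨U, hU, hxU, fun x hx => ?_⟩
  obtain ⟨t, ht, hx₀t, hxt⟩ := hstar x hx
  exact (starCx K x₀).convexHull_subset_space (show t ∈ starFaces K x₀ from ⟨ht, t, ht, Finset.Subset.refl t, hx₀t⟩) hxt

/-- The star lies in the union of the closed simplices containing `x₀`. [folklore] -/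
theorem starCx_space_subset {x₀ : W} {x : W} (hx : x ∈ (starCx K x₀).space) :
    ∃ t' ∈ K.faces, x₀ ∈ convexHull ℝ (t' : Set W) ∧ x ∈ convexHull ℝ (t' : Set W) := by
  obtain ⟨t, ⟨-, t', ht', htt', hx₀⟩, hxt⟩ := Geometry.SimplicialComplex.mem_space_iff.1 hx
  exact ⟨t', ht', hx₀, convexHull_mono (by exact_mod_cast htt') hxt⟩

/-- The star of a pure complex is pure. [folklore] -/
theorem starCx_pure {d : ℕ} (hpure : ∀ r ∈ K.faces, ∃ s ∈ K.faces, r ⊆ s ∧ s.card = d + 1) {x₀ : W}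
    {t : Finset W} (ht : t ∈ (starCx K x₀).faces) : ∃ s ∈ (starCx K x₀).faces, t ⊆ s ∧ s.card = d + 1 := by
  obtain ⟨-, t', ht', htt', hx₀⟩ := ht
  obtain ⟨s, hs, ht's, hcard⟩ := hpure t' ht'
  have hx₀s : x₀ ∈ convexHull ℝ (s : Set W) := convexHull_mono (by exact_mod_cast ht's) hx₀
  exact ⟨s, ⟨hs, s, hs, Finset.Subset.refl s, hx₀s⟩, htt'.trans ht's, hcard⟩

end Star

/-! ### Purity of the lattice refinement -/

section Refinement

variable {N : ℕ}

/-- **The lattice refinement of a pure coordinate complex is pure.** [folklore] -/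
theorem latticeRefinement_pure {K : Geometry.SimplicialComplex ℝ (Fin N → ℝ)} (hK : IsCoordinate K) {d : ℕ}
    (hpure : ∀ r ∈ K.faces, ∃ s ∈ K.faces, r ⊆ s ∧ s.card = d + 1) {m : ℕ} (hm : 0 < m)
    {t : Finset (Fin N → ℝ)} (ht : t ∈ (latticeRefinement K m hm).faces) :
    ∃ t' ∈ (latticeRefinement K m hm).faces, t ⊆ t' ∧ t'.card = d + 1 := by
  classical
  set P := latticeRefinement K m hm with hP
  obtain ⟨r, hr, htr⟩ := exists_convexHull_subset_of_mem_latticeRefinement hK ht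
  obtain ⟨s, hs, hrs, hcard⟩ := hpure r hr
  have hts : convexHull ℝ (t : Set (Fin N → ℝ)) ⊆ convexHull ℝ (s : Set (Fin N → ℝ)) :=
    htr.trans (convexHull_mono (by exact_mod_cast hrs))
  set Fs : Set (Finset (Fin N → ℝ)) := {q | q ∈ P.faces ∧
    convexHull ℝ (q : Set (Fin N → ℝ)) ⊆ convexHull ℝ (s : Set (Fin N → ℝ))} with hFs
  have hFsub : Fs ⊆ P.faces := fun q hq => hq.1
  have hFdown : ∀ q ∈ Fs, ∀ q' ⊆ q, q'.Nonempty → q' ∈ Fs := fun q hq q' hq' hne =>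
    ⟨P.down_closed hq.1 hq' hne, (convexHull_mono (by exact_mod_cast hq')).trans hq.2⟩
  set Ps := subcomplexOf P Fs hFsub hFdown with hPs
  have hPsfin : Ps.faces.Finite := latticeRefinement_faces_finite.subset hFsub
  have hcov : convexHull ℝ (s : Set (Fin N → ℝ)) ⊆ Ps.space := fun x hx => by
    obtain ⟨q, hq, hxq, hqs⟩ := exists_mem_latticeRefinement_of_mem hK hs hx
    exact Geometry.SimplicialComplex.convexHull_subset_space (K := Ps) ⟨hq, hqs⟩ hxq
  obtain ⟨t', ht', htt', hcard'⟩ := exists_subset_card_eq_of_triangulation Ps hPsfin (K.indep hs) hcard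
    (fun q hq => hq.2) hcov (t := t) ⟨ht, hts⟩
  exact ⟨t', ht'.1, htt', hcard'⟩

end Refinement

/-! ### Images of relatively open sets -/

section Homeo

variable {W : Type*} [TopologicalSpace W] {M : Type*} [TopologicalSpace M] [T2Space M]

/-- **Relatively open sets have relatively open images** under a continuous injection on a
compact set, traced on an open subset of the image. [folklore] -/
theorem isOpen_inter_image_of_isOpen {K : Set W} (hK : IsCompact K) {f : W → M} (hf : ContinuousOn f K)
    (hinj : InjOn f K) {U : Set W} (hU : IsOpen U) {V : Set M} (hV : IsOpen V) (hVsub : V ⊆ f '' K) :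
    IsOpen (V ∩ f '' (K ∩ U)) := by
  have hC : IsClosed (f '' (K \ U)) := ((hK.diff hU).image_of_continuousOn (hf.mono sdiff_subset)).isClosed
  have heq : V ∩ f '' (K ∩ U) = V \ f '' (K \ U) := by
    ext p
    constructor
    · rintro ⟨hpV, x, ⟨hxK, hxU⟩, rfl⟩
      refine ⟨hpV, ?_⟩
      rintro ⟨x', ⟨hx'K, hx'U⟩, hxx⟩
      have : x' = x := hinj hx'K hxK hxx
      subst this; exact hx'U hxU
    · rintro ⟨hpV, hpC⟩
      obtain ⟨x, hxK, rfl⟩ := hVsub hpV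
      refine ⟨hpV, x, ⟨hxK, ?_⟩, rfl⟩
      by_contra hxU
      exact hpC ⟨x, ⟨hxK, hxU⟩, rfl⟩
  rw [heq]
  exact hV.sdiff hC

end Homeo

/-! ### Globalising smooth maps near compact sets -/

section Global

variable {n : ℕ}

/-- **Globalisation near a compact set.** A `C^∞` map on an open set `U ⊆ 𝔼 n` agrees, on an open
neighbourhood (inside `U`) of any compact `C ⊆ U`, with a globally `C^∞` map. [folklore] -/
theorem exists_contDiff_eqOn_of_isCompact {U : Set (𝔼 n)} (hU : IsOpen U) {h : (𝔼 n) → (𝔼 n)}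
    (hh : ContDiffOn ℝ ∞ h U) {C : Set (𝔼 n)} (hC : IsCompact C) (hCU : C ⊆ U) :
    ∃ g : (𝔼 n) → (𝔼 n), ContDiff ℝ ∞ g ∧ ∃ V : Set (𝔼 n), IsOpen V ∧ C ⊆ V ∧ V ⊆ U ∧ EqOn g h V := by
  obtain ⟨L, hL, hCL, hLU⟩ := exists_compact_between hC hU hCU
  obtain ⟨θ, h1, h0, -⟩ := exists_contMDiffMap_one_nhds_of_subset_interior (𝓘(ℝ, 𝔼 n)) (n := ⊤) hC.isClosed hCL
  have hθ : ContDiff ℝ ∞ θ := contMDiff_iff_contDiff.1 θ.contMDiff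
  obtain ⟨V, hVo, hCV, hV1⟩ : ∃ V : Set (𝔼 n), IsOpen V ∧ C ⊆ V ∧ ∀ x ∈ V, θ x = 1 := by
    obtain ⟨V, hVo, hCV, hsub⟩ := mem_nhdsSet_iff_exists.1 h1
    exact ⟨V, hVo, hCV, fun x hx => hsub hx⟩
  refine ⟨fun x => θ x • h x, ?_, V ∩ U, hVo.inter hU, subset_inter hCV hCU, inter_subset_right, fun x hx => ?_⟩
  · rw [contDiff_iff_contDiffAt]
    intro x
    by_cases hx : x ∈ U
    · exact hθ.contDiffAt.smul (hh.contDiffAt (hU.mem_nhds hx))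
    · -- near `x ∉ L` the function vanishes
      have hxL : x ∉ L := fun h' => hx (hLU h')
      have hev : (fun y => θ y • h y) =ᶠ[𝓝 x] fun _ => 0 := by
        filter_upwards [hL.isClosed.isOpen_compl.mem_nhds hxL] with y hy
        rw [h0 y hy, zero_smul]
      exact (contDiffAt_const (c := (0 : 𝔼 n))).congr_of_eventuallyEq hev
  · show θ x • h x = h x
    rw [hV1 x hx.1, one_smul]

end Global

/-! ### Part 1: local complexes -/

section Local

variable {n : ℕ} {M : Type*} [TopologicalSpace M] [T2Space M] [ChartedSpace (EuclideanSpace ℝ (Fin n)) M]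
  (st : TriState n M)

/-- Auxiliary (`K_finite`). [folklore] -/
theorem TriState.K_finite : st.K.faces.Finite := st.hK.faces_finite

/-- Auxiliary (`K_space_isCompact`). [folklore] -/
theorem TriState.isCompact_space : IsCompact st.K.space := isCompact_space_of_finite st.K_finite

/-- Auxiliary (`f_continuousOn`). [folklore] -/
theorem TriState.continuousOn_f : ContinuousOn st.f st.K.space := continuousOn_space_of_forall st.K_finite st.cont

/-- **The local complex of a state at a point** (star of a fine lattice refinement). [folklore] -/
theorem exists_local_complex {x₀ : Fin st.N → ℝ} (hx₀ : x₀ ∈ st.K.space)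
    {O : Set M} (hO : IsOpen O) (hfx : st.f x₀ ∈ O) :
    ∃ St : Geometry.SimplicialComplex ℝ (Fin st.N → ℝ), St.faces.Finite ∧
      (∀ t ∈ St.faces, ∃ t' ∈ St.faces, t ⊆ t' ∧ t'.card = n + 1) ∧
      (∀ t ∈ St.faces, convexHull ℝ (t : Set (Fin st.N → ℝ)) ⊆ st.K.space ∧
        st.f '' convexHull ℝ (t : Set (Fin st.N → ℝ)) ⊆ O ∧
        ∃ s ∈ st.K.faces, s.card = n + 1 ∧ convexHull ℝ (t : Set (Fin st.N → ℝ)) ⊆ convexHull ℝ (s : Set (Fin st.N → ℝ))) ∧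
      (∃ U : Set (Fin st.N → ℝ), IsOpen U ∧ x₀ ∈ U ∧ st.K.space ∩ U ⊆ St.space) ∧
      St.space ⊆ st.K.space := by
  classical
  -- a uniform radius `δ` about `x₀` inside `f ⁻¹' O`
  obtain ⟨δ, hδ, hδO⟩ : ∃ δ > 0, ∀ x ∈ st.K.space, dist x x₀ < δ → st.f x ∈ O := by
    have hc := (st.continuousOn_f x₀ hx₀)
    have hmem : st.f ⁻¹' O ∈ 𝓝[st.K.space] x₀ := hc (hO.mem_nhds hfx)
    obtain ⟨δ, hδ, hsub⟩ := Metric.mem_nhdsWithin_iff.1 hmem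
    exact ⟨δ, hδ, fun x hx hd => hsub ⟨hd, hx⟩⟩
  -- the refinement
  obtain ⟨m, hm⟩ := exists_nat_gt (1 / δ)
  have hm0 : 0 < m := by
    have : (0 : ℝ) < m := lt_trans (by positivity) hm
    exact_mod_cast this
  have hmesh : (1 : ℝ) / m < δ := by
    have hmR : (0 : ℝ) < m := by exact_mod_cast hm0
    rw [div_lt_iff₀ hmR]
    rw [div_lt_iff₀ hδ] at hm
    linarith [mul_comm δ (m : ℝ)]
  set P := latticeRefinement st.K m hm0 with hP
  have hPfin : P.faces.Finite := latticeRefinement_faces_finite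
  have hPspace : P.space = st.K.space := latticeRefinement_space st.hK
  have hPpure : ∀ r ∈ P.faces, ∃ r' ∈ P.faces, r ⊆ r' ∧ r'.card = n + 1 := fun r hr =>
    latticeRefinement_pure st.hK st.pure hm0 hr
  have hdist : ∀ t ∈ P.faces, ∀ x ∈ convexHull ℝ (t : Set (Fin st.N → ℝ)), ∀ y ∈ convexHull ℝ (t : Set (Fin st.N → ℝ)),
      dist x y ≤ 1 / m := fun t ht x hx y hy => by
    rw [dist_pi_le_iff (by positivity)]
    intro i
    rw [Real.dist_eq]
    exact abs_sub_le_of_mem_latticeRefinement st.hK ht hx hy i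
  -- the star of `x₀`
  have hx₀P : x₀ ∈ P.space := by rw [hPspace]; exact hx₀
  refine ⟨starCx P x₀, starCx_finite hPfin x₀, fun t ht => starCx_pure hPpure ht, fun t ht => ?_, ?_, ?_⟩
  · obtain ⟨htP, t', ht', htt', hx₀t'⟩ := ht
    have hsub : convexHull ℝ (t : Set (Fin st.N → ℝ)) ⊆ convexHull ℝ (t' : Set (Fin st.N → ℝ)) :=
      convexHull_mono (by exact_mod_cast htt')
    have hK : convexHull ℝ (t' : Set (Fin st.N → ℝ)) ⊆ st.K.space := by
      rw [← hPspace]; exact P.convexHull_subset_space ht'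
    refine ⟨hsub.trans hK, ?_, ?_⟩
    · rintro _ ⟨x, hx, rfl⟩
      refine hδO x (hK (hsub hx)) ((hdist t' ht' x (hsub hx) x₀ hx₀t').trans_lt hmesh)
    · obtain ⟨r, hr, ht'r⟩ := exists_convexHull_subset_of_mem_latticeRefinement st.hK ht'
      obtain ⟨s, hs, hrs, hcard⟩ := st.pure r hr
      exact ⟨s, hs, hcard, hsub.trans (ht'r.trans (convexHull_mono (by exact_mod_cast hrs)))⟩
  · obtain ⟨U, hU, hxU, hsub⟩ := starCx_space_supset hPfin x₀
    exact ⟨U, hU, hxU, by rw [← hPspace]; exact hsub⟩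
  · intro x hx
    obtain ⟨t', ht', -, hxt'⟩ := starCx_space_subset hx
    rw [← hPspace]; exact P.convexHull_subset_space ht' hxt'

/-- **The local image complex.** For a chart `i` with its invariants and a point `x₀` of `K.space`
with `f x₀ ∈ W i ∩ O` (`O` open), a finite pure complex `Q` of `𝔼 n` around `φ i (f x₀)` whose
closed simplices are injective affine images of small simplices of `K.space` mapped by `f` into
`W i ∩ O`. [folklore] -/
theorem exists_local_image_complex {i : ℕ} (hi : ChartInv st i) {x₀ : Fin st.N → ℝ} (hx₀ : x₀ ∈ st.K.space)
    {O : Set M} (hO : IsOpen O) (hfx : st.f x₀ ∈ st.W i ∩ O) :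
    ∃ Q : Geometry.SimplicialComplex ℝ (𝔼 n), Q.faces.Finite ∧ Q.space ∈ 𝓝 (st.φ i (st.f x₀)) ∧
      (∀ σ ∈ Q.faces, ∃ σ' ∈ Q.faces, σ ⊆ σ' ∧ σ'.card = n + 1) ∧
      ∀ σ ∈ Q.faces, ∃ t : Finset (Fin st.N → ℝ), ∃ A : (Fin st.N → ℝ) →ᵃ[ℝ] 𝔼 n, ∃ s ∈ st.K.faces,
        s.card = n + 1 ∧ convexHull ℝ (t : Set (Fin st.N → ℝ)) ⊆ convexHull ℝ (s : Set (Fin st.N → ℝ)) ∧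
        convexHull ℝ (t : Set (Fin st.N → ℝ)) ⊆ st.K.space ∧
        st.f '' convexHull ℝ (t : Set (Fin st.N → ℝ)) ⊆ st.W i ∩ O ∧
        EqOn (st.φ i ∘ st.f) A (convexHull ℝ (t : Set (Fin st.N → ℝ))) ∧
        InjOn A (convexHull ℝ (t : Set (Fin st.N → ℝ))) ∧
        convexHull ℝ (σ : Set (𝔼 n)) = A '' convexHull ℝ (t : Set (Fin st.N → ℝ)) ∧ t.card = σ.card := by
  classical
  obtain ⟨St, hStfin, hStpure, hSt, ⟨U, hU, hxU, hUsub⟩, hStK⟩ :=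
    exists_local_complex st hx₀ (hi.isOpen.inter hO) hfx
  set ψ : (Fin st.N → ℝ) → 𝔼 n := st.φ i ∘ st.f with hψ
  -- `ψ` is simplexwise affine and injective on the star
  have haff : ∀ t ∈ St.faces, ∃ A : (Fin st.N → ℝ) →ᵃ[ℝ] 𝔼 n, EqOn ψ A (convexHull ℝ (t : Set (Fin st.N → ℝ))) := by
    intro t ht
    obtain ⟨-, hfO, s, hs, -, hts⟩ := hSt t ht
    obtain ⟨A, hA⟩ := hi.affine s hs
    exact ⟨A, fun x hx => hA ⟨hts hx, (hfO ⟨x, hx, rfl⟩).1⟩⟩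
  have hinjψ : InjOn ψ St.space := fun x hx y hy hxy => by
    obtain ⟨t, ht, hxt⟩ := Geometry.SimplicialComplex.mem_space_iff.1 hx
    obtain ⟨t', ht', hyt'⟩ := Geometry.SimplicialComplex.mem_space_iff.1 hy
    have hfxW : st.f x ∈ st.W i := ((hSt t ht).2.1 ⟨x, hxt, rfl⟩).1
    have hfyW : st.f y ∈ st.W i := ((hSt t' ht').2.1 ⟨y, hyt', rfl⟩).1
    exact st.inj (hStK hx) (hStK hy) (hi.inj hfxW hfyW hxy)
  obtain ⟨Q, hQfaces, hQhull⟩ := exists_simplicialComplex_image St ψ haff hinjψ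
  have hQspace : Q.space = ψ '' St.space := by
    refine Subset.antisymm (fun z hz => ?_) ?_
    · obtain ⟨σ, hσ, hzσ⟩ := Geometry.SimplicialComplex.mem_space_iff.1 hz
      obtain ⟨t, ht, rfl⟩ := (hQfaces σ).1 hσ
      rw [hQhull t ht] at hzσ
      obtain ⟨x, hx, rfl⟩ := hzσ
      exact ⟨x, St.convexHull_subset_space ht hx, rfl⟩
    · rintro _ ⟨x, hx, rfl⟩
      obtain ⟨t, ht, hxt⟩ := Geometry.SimplicialComplex.mem_space_iff.1 hx
      have h : ψ x ∈ ψ '' convexHull ℝ (t : Set (Fin st.N → ℝ)) := ⟨x, hxt, rfl⟩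
      rw [← hQhull t ht] at h
      exact Q.convexHull_subset_space ((hQfaces _).2 ⟨t, ht, rfl⟩) h
  refine ⟨Q, ?_, ?_, ?_, ?_⟩
  · have : Q.faces ⊆ (fun t => t.image ψ) '' St.faces := fun σ hσ => by
      obtain ⟨t, ht, rfl⟩ := (hQfaces σ).1 hσ; exact ⟨t, ht, rfl⟩
    exact (hStfin.image _).subset this
  · -- a neighbourhood: `φ i '' ((W i ∩ O) ∩ f '' (K.space ∩ U))` is open and inside `Q.space`
    have hVo : IsOpen ((st.W i ∩ O) ∩ st.f '' (st.K.space ∩ U)) :=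
      isOpen_inter_image_of_isOpen st.isCompact_space st.continuousOn_f st.inj hU (hi.isOpen.inter hO)
        (inter_subset_left.trans hi.subset)
    have himgo : IsOpen (st.φ i '' ((st.W i ∩ O) ∩ st.f '' (st.K.space ∩ U))) :=
      hi.openMap _ (inter_subset_left.trans inter_subset_left) hVo
    refine Filter.mem_of_superset (himgo.mem_nhds ⟨st.f x₀, ⟨hfx, x₀, ⟨hx₀, hxU⟩, rfl⟩, rfl⟩) ?_
    rintro _ ⟨_, ⟨-, x, hx, rfl⟩, rfl⟩
    rw [hQspace]
    exact ⟨x, hUsub hx, rfl⟩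
  · -- purity
    intro σ hσ
    obtain ⟨t, ht, rfl⟩ := (hQfaces σ).1 hσ
    obtain ⟨t', ht', htt', hcard⟩ := hStpure t ht
    refine ⟨t'.image ψ, (hQfaces _).2 ⟨t', ht', rfl⟩, Finset.image_subset_image htt', ?_⟩
    rw [Finset.card_image_of_injOn (hinjψ.mono fun v hv => St.convexHull_subset_space ht' (subset_convexHull ℝ _ hv)), hcard]
  · intro σ hσ
    obtain ⟨t, ht, rfl⟩ := (hQfaces σ).1 hσ
    obtain ⟨A, hA⟩ := haff t ht
    obtain ⟨hK, hfO, s, hs, hcard, hts⟩ := hSt t ht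
    have hinjA : InjOn A (convexHull ℝ (t : Set (Fin st.N → ℝ))) := fun x hx y hy hxy => by
      rw [← hA hx, ← hA hy] at hxy
      exact hinjψ (St.convexHull_subset_space ht hx) (St.convexHull_subset_space ht hy) hxy
    refine ⟨t, A, s, hs, hcard, hts, hK, hfO, hA, hinjA, ?_, ?_⟩
    · rw [hQhull t ht]; exact image_congr fun x hx => hA hx
    · rw [Finset.card_image_of_injOn (hinjψ.mono fun v hv => St.convexHull_subset_space ht (subset_convexHull ℝ _ hv))]

/-! ### The chart of a state from its invariants -/

variable [Nonempty M]

/-- The partial equivalence of chart `i`. [folklore] -/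
def chartPE {i : ℕ} (hi : ChartInv st i) : PartialEquiv M (𝔼 n) := hi.inj.toPartialEquiv (st.φ i) (st.W i)

/-- Auxiliary (`chartPE_source`). [folklore] -/
theorem chartPE_source {i : ℕ} (hi : ChartInv st i) : (chartPE st hi).source = st.W i := rfl

/-- Auxiliary (`chartPE_apply`). [folklore] -/
theorem chartPE_apply {i : ℕ} (hi : ChartInv st i) (q : M) : chartPE st hi q = st.φ i q := rfl

/-- Auxiliary (`chartPE_target`). [folklore] -/
theorem chartPE_target {i : ℕ} (hi : ChartInv st i) : (chartPE st hi).target = st.φ i '' st.W i := rfl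

/-- **The PL chart `i` of a state** as an open partial homeomorphism. [folklore] -/
def chartOPH {i : ℕ} (hi : ChartInv st i) : OpenPartialHomeomorph M (𝔼 n) :=
  OpenPartialHomeomorph.ofContinuousOpenRestrict (chartPE st hi) hi.cont
    (by
      intro O hO
      obtain ⟨O', hO', rfl⟩ := isOpen_induced_iff.1 hO
      have : (chartPE st hi).source.restrict (chartPE st hi) '' (Subtype.val ⁻¹' O') = st.φ i '' (st.W i ∩ O') := by
        ext z
        simp only [mem_image, mem_preimage, restrict_apply, Subtype.exists, chartPE_source, exists_and_right,
          mem_inter_iff, chartPE_apply]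
        constructor
        · rintro ⟨q, ⟨hq, hqO⟩, rfl⟩; exact ⟨q, ⟨hq, hqO⟩, rfl⟩
        · rintro ⟨q, ⟨hq, hqO⟩, rfl⟩; exact ⟨q, ⟨hq, hqO⟩, rfl⟩
      rw [this]
      exact hi.openMap _ inter_subset_left (hi.isOpen.inter hO'))
    hi.isOpen

/-- Auxiliary (`chartOPH_source`). [folklore] -/
theorem chartOPH_source {i : ℕ} (hi : ChartInv st i) : (chartOPH st hi).source = st.W i := rfl

/-- Auxiliary (`chartOPH_apply`). [folklore] -/
theorem chartOPH_apply {i : ℕ} (hi : ChartInv st i) (q : M) : chartOPH st hi q = st.φ i q := rfl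

/-- Auxiliary (`chartOPH_target`). [folklore] -/
theorem chartOPH_target {i : ℕ} (hi : ChartInv st i) : (chartOPH st hi).target = st.φ i '' st.W i := rfl

/-- Auxiliary (`chartOPH_symm_apply`). [folklore] -/
theorem chartOPH_symm_apply {i : ℕ} (hi : ChartInv st i) {q : M} (hq : q ∈ st.W i) :
    (chartOPH st hi).symm (st.φ i q) = q :=
  (chartOPH st hi).left_inv (show q ∈ (chartOPH st hi).source from hq)

/-! ### PL transitions and piecewise smooth transitions, locally -/

/-- **The chart transitions are PL**, locally at a point of the overlap. [folklore] -/
theorem local_pl {i j : ℕ} (hi : ChartInv st i) (hj : ChartInv st j) {p : M} (hp : p ∈ st.W i ∩ st.W j) :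
    ∃ Q : Geometry.SimplicialComplex ℝ (𝔼 n), Q.faces.Finite ∧ Q.space ∈ 𝓝 (st.φ i p) ∧
      Q.space ⊆ ((chartOPH st hi).symm ≫ₕ chartOPH st hj).source ∧
      ∀ σ ∈ Q.faces, ∃ g : (𝔼 n) →ᵃ[ℝ] 𝔼 n, EqOn ((chartOPH st hi).symm ≫ₕ chartOPH st hj) g (convexHull ℝ (σ : Set (𝔼 n))) := by
  obtain ⟨x₀, hx₀, hfx₀⟩ := hi.subset hp.1
  obtain ⟨Q, hQfin, hQnhds, -, hQ⟩ := exists_local_image_complex st hi hx₀ hj.isOpen (by rw [hfx₀]; exact hp)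
  rw [hfx₀] at hQnhds
  refine ⟨Q, hQfin, hQnhds, fun z hz => ?_, fun σ hσ => ?_⟩
  · obtain ⟨σ, hσ, hzσ⟩ := Geometry.SimplicialComplex.mem_space_iff.1 hz
    obtain ⟨t, A, s, -, -, -, -, hfWO, hA, -, hhull, -⟩ := hQ σ hσ
    rw [hhull] at hzσ
    obtain ⟨x, hx, rfl⟩ := hzσ
    obtain ⟨hW, hO⟩ := hfWO ⟨x, hx, rfl⟩
    rw [OpenPartialHomeomorph.trans_source, OpenPartialHomeomorph.symm_source, chartOPH_target, mem_inter_iff, mem_preimage,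
      ← hA hx]
    refine ⟨⟨st.f x, hW, rfl⟩, ?_⟩
    show (chartOPH st hi).symm (st.φ i (st.f x)) ∈ (chartOPH st hj).source
    rw [chartOPH_symm_apply st hi hW]
    exact hO
  · obtain ⟨t, A, s, hs, -, hts, -, hfWO, hA, hinjA, hhull, -⟩ := hQ σ hσ
    obtain ⟨Aj, hAj⟩ := hj.affine s hs
    obtain ⟨L, hL⟩ := exists_affine_leftInv A hinjA
    refine ⟨Aj.comp L, fun z hz => ?_⟩
    rw [hhull] at hz
    obtain ⟨x, hx, rfl⟩ := hz
    obtain ⟨hW, hO⟩ := hfWO ⟨x, hx, rfl⟩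
    show (chartOPH st hj) ((chartOPH st hi).symm (A x)) = Aj (L (A x))
    rw [hL x hx]
    have h1 : A x = st.φ i (st.f x) := (hA hx).symm
    rw [h1]
    show st.φ j ((chartOPH st hi).symm (st.φ i (st.f x))) = Aj x
    rw [chartOPH_symm_apply st hi hW]
    exact hAj ⟨hts hx, hO⟩

/-- The direction space of a top image simplex is everything. [folklore] -/
theorem vectorSpan_eq_top_of_card {σ : Finset (𝔼 n)} (hind : AffineIndependent ℝ ((↑) : σ → 𝔼 n))
    (hcard : σ.card = n + 1) : vectorSpan ℝ (σ : Set (𝔼 n)) = ⊤ := by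
  have h2 := hind.affineSpan_eq_top_iff_card_eq_finrank_add_one
  rw [Subtype.range_coe] at h2
  have htop : affineSpan ℝ (σ : Set (𝔼 n)) = ⊤ := h2.2 (by rw [Fintype.card_coe, hcard, finrank_euclideanSpace_fin])
  rw [← direction_affineSpan, htop, AffineSubspace.direction_top]

/-- **The transitions to the smooth charts are piecewise smooth of maximal rank**, locally at a
point of the overlap. [folklore] -/
theorem local_pd {i : ℕ} (hi : ChartInv st i) {e' : OpenPartialHomeomorph M (𝔼 n)} (he' : e' ∈ atlas (𝔼 n) M)
    {p : M} (hp : p ∈ st.W i ∩ e'.source) :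
    ∃ Q : Geometry.SimplicialComplex ℝ (𝔼 n), Q.faces.Finite ∧ Q.space ∈ 𝓝 (st.φ i p) ∧
      Q.space ⊆ ((chartOPH st hi).symm.trans e').source ∧
      ∀ σ ∈ Q.faces, ∃ g : (𝔼 n) → 𝔼 n, ContDiff ℝ ∞ g ∧
        EqOn (e' ∘ (chartOPH st hi).symm) g (convexHull ℝ (σ : Set (𝔼 n))) ∧
        ∀ z ∈ convexHull ℝ (σ : Set (𝔼 n)), Injective (fderiv ℝ g z) := by
  obtain ⟨x₀, hx₀, hfx₀⟩ := hi.subset hp.1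
  obtain ⟨Q, hQfin, hQnhds, hQpure, hQ⟩ := exists_local_image_complex st hi hx₀ e'.open_source (by rw [hfx₀]; exact hp)
  rw [hfx₀] at hQnhds
  refine ⟨Q, hQfin, hQnhds, fun z hz => ?_, fun σ hσ => ?_⟩
  · obtain ⟨σ, hσ, hzσ⟩ := Geometry.SimplicialComplex.mem_space_iff.1 hz
    obtain ⟨t, A, s, -, -, -, -, hfWO, hA, -, hhull, -⟩ := hQ σ hσ
    rw [hhull] at hzσ
    obtain ⟨x, hx, rfl⟩ := hzσ
    obtain ⟨hW, hO⟩ := hfWO ⟨x, hx, rfl⟩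
    rw [OpenPartialHomeomorph.trans_source, OpenPartialHomeomorph.symm_source, chartOPH_target, mem_inter_iff, mem_preimage,
      ← hA hx]
    refine ⟨⟨st.f x, hW, rfl⟩, ?_⟩
    show (chartOPH st hi).symm (st.φ i (st.f x)) ∈ e'.source
    rw [chartOPH_symm_apply st hi hW]
    exact hO
  · -- pass to a top coface `σ⁺` and its data
    obtain ⟨σp, hσp, hσσp, hcardp⟩ := hQpure σ hσ
    obtain ⟨t, A, s, hs, hcard, hts, hK, hfWO, hA, hinjA, hhull, htcard⟩ := hQ σp hσp
    obtain ⟨O, G, hOo, hsO, hG, hEqG, hDG⟩ := (st.model s hs hcard e' he').out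
    obtain ⟨L, hL⟩ := exists_affine_leftInv A hinjA
    -- the closed top simplex is the injective affine image of `conv t`; `L` maps it back
    have hLimg : L '' convexHull ℝ (σp : Set (𝔼 n)) ⊆ convexHull ℝ (t : Set (Fin st.N → ℝ)) := by
      rw [hhull]; rintro _ ⟨_, ⟨x, hx, rfl⟩, rfl⟩; rw [hL x hx]; exact hx
    have hLmem : ∀ z ∈ convexHull ℝ (σp : Set (𝔼 n)), L z ∈ convexHull ℝ (t : Set (Fin st.N → ℝ)) ∧ A (L z) = z ∧
        st.f (L z) ∈ st.W i ∩ e'.source := fun z hz => by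
      rw [hhull] at hz
      obtain ⟨x, hx, rfl⟩ := hz
      rw [hL x hx]
      exact ⟨hx, rfl, hfWO ⟨x, hx, rfl⟩⟩
    -- the model `G ∘ L` on the open set `L ⁻¹' O`
    have hLc : Continuous L := L.continuous_of_finiteDimensional
    have hopen : IsOpen (L ⁻¹' O) := hOo.preimage hLc
    have hsub : convexHull ℝ (σp : Set (𝔼 n)) ⊆ L ⁻¹' O := fun z hz => by
      obtain ⟨hLz, -, -, hsrc⟩ := hLmem z hz
      exact hsO ⟨hts hLz, hsrc⟩
    have hh : ContDiffOn ℝ ∞ (fun z => G (L z)) (L ⁻¹' O) := hG.comp (contDiff_affineMap L).contDiffOn fun z hz => hz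
    obtain ⟨g, hg, V, hVo, hσV, hVO, hgV⟩ := exists_contDiff_eqOn_of_isCompact hopen hh
      (σp.finite_toSet.isCompact_convexHull (𝕜 := ℝ)) hsub
    refine ⟨g, hg, fun z hz => ?_, fun z hz => ?_⟩
    · have hz' : z ∈ convexHull ℝ (σp : Set (𝔼 n)) := convexHull_mono (by exact_mod_cast hσσp) hz
      obtain ⟨hLz, hALz, hW, hsrc⟩ := hLmem z hz'
      rw [hgV (hσV hz')]
      show e' ((chartOPH st hi).symm z) = G (L z)
      have h1 : z = st.φ i (st.f (L z)) :=
        calc z = A (L z) := hALz.symm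
          _ = st.φ i (st.f (L z)) := (hA hLz).symm
      conv_lhs => rw [h1]
      rw [chartOPH_symm_apply st hi hW]
      exact hEqG ⟨hts hLz, hsrc⟩
    · have hz' : z ∈ convexHull ℝ (σp : Set (𝔼 n)) := convexHull_mono (by exact_mod_cast hσσp) hz
      obtain ⟨hLz, hALz, hW, hsrc⟩ := hLmem z hz'
      -- `fderiv g z = fderiv G (L z) ∘ L.linear`
      have hev : g =ᶠ[𝓝 z] fun z => G (L z) := Filter.eventuallyEq_of_mem (hVo.mem_nhds (hσV hz')) hgV
      have hdL : HasFDerivAt L (LinearMap.toContinuousLinearMap L.linear) z := hasFDerivAt_affineMap L z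
      have hdG : HasFDerivAt G (fderiv ℝ G (L z)) (L z) :=
        ((hG.contDiffAt (hOo.mem_nhds (hsub hz'))).differentiableAt (by simp)).hasFDerivAt
      have hcomp : HasFDerivAt (fun z => G (L z)) ((fderiv ℝ G (L z)).comp (LinearMap.toContinuousLinearMap L.linear)) z :=
        hdG.comp z hdL
      rw [hev.fderiv_eq, hcomp.fderiv]
      intro w₁ w₂ hw
      have hsub0 : (fderiv ℝ G (L z)) (L.linear (w₁ - w₂)) = 0 := by
        rw [map_sub, map_sub]
        exact sub_eq_zero.2 hw
      -- `L.linear (w₁ - w₂) ∈ vectorSpan s`, so it vanishes, and `L` is injective on directions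
      have htop : vectorSpan ℝ (σp : Set (𝔼 n)) = ⊤ := vectorSpan_eq_top_of_card (Q.indep hσp) hcardp
      have hmem : w₁ - w₂ ∈ vectorSpan ℝ (σp : Set (𝔼 n)) := by rw [htop]; exact Submodule.mem_top
      have hdir : L.linear (w₁ - w₂) ∈ vectorSpan ℝ (s : Set (Fin st.N → ℝ)) :=
        linear_mem_vectorSpan L (hLimg.trans hts) hmem
      have h0 : L.linear (w₁ - w₂) = 0 := hDG (L z) ⟨hts hLz, hsrc⟩ _ hdir hsub0
      have hinjL : InjOn L (convexHull ℝ (σp : Set (𝔼 n))) := fun a ha b hb hab => by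
        rw [← (hLmem a ha).2.1, ← (hLmem b hb).2.1, hab]
      exact sub_eq_zero.1 (linear_eq_zero_of_injOn_convexHull L hinjL hmem h0)

end Local

/-! ### Part 2: the limit charts and the theorem -/

section Charts

variable {n : ℕ} {M : Type*} [TopologicalSpace M] [T2Space M] [ChartedSpace (EuclideanSpace ℝ (Fin n)) M]

/-- Charts with the same data coincide. [folklore] -/
theorem chartOPH_eq_of_eq [Nonempty M] {st st' : TriState n M} {i : ℕ} (hi : ChartInv st i) (hi' : ChartInv st' i)
    (hW : st.W i = st'.W i) (hφ : st.φ i = st'.φ i) : chartOPH st hi = chartOPH st' hi' := by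
  apply OpenPartialHomeomorph.toPartialEquiv_injective
  refine PartialEquiv.ext (fun q => ?_) (fun z => ?_) ?_
  · show st.φ i q = st'.φ i q; rw [hφ]
  · show Function.invFunOn (st.φ i) (st.W i) z = Function.invFunOn (st'.φ i) (st'.W i) z
    rw [hW, hφ]
  · show st.W i = st'.W i; exact hW

end Charts

section Assembly

universe u

variable {n : ℕ} (hcomp : IsPLOn.comp (n := n)) (haff : isPLOn_affineMap (n := n) (m := n))
  {M : Type u} [TopologicalSpace M] [T2Space M] [SecondCountableTopology M]
  [cDIFF : ChartedSpace (EuclideanSpace ℝ (Fin n)) M] [IsManifold (𝓡 n) ∞ M]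

/-- **Empty manifolds**: the smooth atlas itself is a (vacuously) PL atlas, Whitehead compatible.
[folklore] -/
theorem triangulation_of_isEmpty [IsEmpty M] :
    ∃ cPL : ChartedSpace (𝔼 n) M, @IsPLManifold n hcomp haff M _ cPL ∧ IsWhiteheadCompatible n M cPL cDIFF := by
  have hsrc : ∀ (e : OpenPartialHomeomorph M (𝔼 n)) (e' : OpenPartialHomeomorph M (𝔼 n)), (e.symm ≫ₕ e').source = ∅ :=
    fun e e' => Set.eq_empty_of_forall_notMem fun z _ => isEmptyElim (e.symm z)
  have hG : @HasGroupoid _ _ M _ cDIFF (plGroupoid n hcomp haff) := ⟨fun {e e'} _ _ => by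
    rw [mem_plGroupoid_iff]
    constructor
    · intro a ha; rw [hsrc] at ha; exact ha.elim
    · intro a ha
      have : (e.symm ≫ₕ e').target = ∅ := by
        rw [← OpenPartialHomeomorph.image_source_eq_target, hsrc, image_empty]
      rw [this] at ha; exact ha.elim⟩
  refine ⟨cDIFF, @IsPLManifold.mk n hcomp haff M _ cDIFF hG, fun e _ e' _ => ?_⟩
  intro a ha
  have : (e.symm.trans e').source = ∅ := hsrc e e'
  rw [this] at ha; exact ha.elim

variable [Nonempty M]

/-- The sequence of pieces. [folklore] -/
def pcs (M : Type u) [TopologicalSpace M] [T2Space M] [SecondCountableTopology M]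
    [ChartedSpace (EuclideanSpace ℝ (Fin n)) M] : ℕ → Option (Piece n M) :=
  (exists_cover_pieces (n := n) (M := M)).choose

/-- Auxiliary (`pcs_cover`). [folklore] -/
theorem pcs_cover (p : M) : ∃ k, ∃ P : Piece n M, pcs (n := n) M k = some P ∧ p ∈ P.e.symm '' openBox (P.a 0) (P.b 0) :=
  (exists_cover_pieces (n := n) (M := M)).choose_spec.1 p

/-- Auxiliary (`pcs_finite`). [folklore] -/
theorem pcs_finite (k : ℕ) (P : Piece n M) (h : pcs (n := n) M k = some P) :
    {k' | ∃ P' : Piece n M, pcs (n := n) M k' = some P' ∧ (P'.e.symm '' P'.B 7 ∩ P.e.symm '' P.B 7).Nonempty}.Finite :=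
  (exists_cover_pieces (n := n) (M := M)).choose_spec.2 k P h

/-- The good states of the construction. [folklore] -/
def GS (k : ℕ) : GoodState n M k := seq (pcs (n := n) M) k

/-- The stage after which chart `j` never changes (with its specification). [folklore] -/
theorem exists_kst (j : ℕ) : ∃ k₀, j < k₀ ∧ ∀ k, k₀ ≤ k →
    (GS (n := n) (M := M) k).st.W j = (GS (n := n) (M := M) k₀).st.W j ∧
    (GS (n := n) (M := M) k).st.φ j = (GS (n := n) (M := M) k₀).st.φ j ∧
    (GS (n := n) (M := M) k).st.C' j = (GS (n := n) (M := M) k₀).st.C' j :=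
  chart_eventually_const (pcs (n := n) M) (pcs_finite (n := n) (M := M)) j

/-- The stabilisation stage of chart `j`. [folklore] -/
def kst (j : ℕ) : ℕ := (exists_kst (n := n) (M := M) j).choose

/-- Auxiliary (`kst_spec`). [folklore] -/
theorem kst_spec (j : ℕ) {k : ℕ} (hk : kst (n := n) (M := M) j ≤ k) :
    (GS (n := n) (M := M) k).st.W j = (GS (n := n) (M := M) (kst (n := n) (M := M) j)).st.W j ∧
    (GS (n := n) (M := M) k).st.φ j = (GS (n := n) (M := M) (kst (n := n) (M := M) j)).st.φ j ∧
    (GS (n := n) (M := M) k).st.C' j = (GS (n := n) (M := M) (kst (n := n) (M := M) j)).st.C' j :=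
  (exists_kst (n := n) (M := M) j).choose_spec.2 k hk

/-- **The limit PL chart `j`.** [folklore] -/
def finalChart (j : ℕ) : OpenPartialHomeomorph M (𝔼 n) :=
  chartOPH (GS (n := n) (M := M) (kst (n := n) (M := M) j)).st ((GS (n := n) (M := M) (kst (n := n) (M := M) j)).inv j)

/-- The limit chart is the chart of every late stage. [folklore] -/
theorem finalChart_eq (j : ℕ) {k : ℕ} (hk : kst (n := n) (M := M) j ≤ k) :
    finalChart (n := n) (M := M) j = chartOPH (GS (n := n) (M := M) k).st ((GS (n := n) (M := M) k).inv j) := by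
  obtain ⟨hW, hφ, -⟩ := kst_spec (n := n) (M := M) j hk
  exact chartOPH_eq_of_eq _ _ hW.symm hφ.symm

/-- Auxiliary (`finalChart_source`). [folklore] -/
theorem finalChart_source (j : ℕ) {k : ℕ} (hk : kst (n := n) (M := M) j ≤ k) :
    (finalChart (n := n) (M := M) j).source = (GS (n := n) (M := M) k).st.W j := by
  rw [finalChart_eq j hk]; rfl

/-- The chart index of a point: a chart whose core eventually contains the point forever.
[folklore] -/
theorem exists_jOf (p : M) : ∃ j k₁, ∀ k, k₁ ≤ k → p ∈ (GS (n := n) (M := M) k).st.C' j :=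
  point_eventually_core (pcs (n := n) M) (pcs_cover (n := n) (M := M)) (pcs_finite (n := n) (M := M)) p

/-- The chart index of a point. [folklore] -/
def jOf (p : M) : ℕ := (exists_jOf (n := n) (M := M) p).choose

/-- Every point lies in the source of its limit chart. [folklore] -/
theorem mem_finalChart_source (p : M) : p ∈ (finalChart (n := n) (M := M) (jOf (n := n) (M := M) p)).source := by
  obtain ⟨k₁, hk₁⟩ := (exists_jOf (n := n) (M := M) p).choose_spec
  set j := jOf (n := n) (M := M) p with hj
  set k := max k₁ (kst (n := n) (M := M) j) with hk
  rw [finalChart_source j (le_max_right _ _ : kst j ≤ k)]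
  exact ((GS (n := n) (M := M) k).inv j).core (hk₁ k (le_max_left _ _))

/-- **The PL charted space** of the construction. [folklore] -/
@[reducible] def plCharted : ChartedSpace (𝔼 n) M where
  atlas := Set.range (finalChart (n := n) (M := M))
  chartAt p := finalChart (n := n) (M := M) (jOf (n := n) (M := M) p)
  mem_chart_source p := mem_finalChart_source (n := n) (M := M) p
  chart_mem_atlas p := ⟨jOf p, rfl⟩

/-- **The transitions of the limit charts are PL.** [folklore] -/
theorem isPLOn_transition (i j : ℕ) :
    IsPLOn n n ((finalChart (n := n) (M := M) i).symm ≫ₕ finalChart (n := n) (M := M) j)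
      ((finalChart (n := n) (M := M) i).symm ≫ₕ finalChart (n := n) (M := M) j).source := by
  set k := max (kst (n := n) (M := M) i) (kst (n := n) (M := M) j) with hk
  rw [finalChart_eq i (le_max_left _ _ : kst i ≤ k), finalChart_eq j (le_max_right _ _ : kst j ≤ k)]
  set st := (GS (n := n) (M := M) k).st with hst
  have hi := (GS (n := n) (M := M) k).inv i
  have hj := (GS (n := n) (M := M) k).inv j
  intro a ha
  -- `a = φ i p` with `p ∈ W i ∩ W j`
  have hp : (chartOPH st hi).symm a ∈ st.W i ∩ st.W j := by
    rw [OpenPartialHomeomorph.trans_source] at ha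
    exact ⟨(chartOPH st hi).map_target ha.1, ha.2⟩
  have ha' : a = st.φ i ((chartOPH st hi).symm a) := by
    have ha1 : a ∈ (chartOPH st hi).target := by rw [OpenPartialHomeomorph.trans_source] at ha; exact ha.1
    exact ((chartOPH st hi).right_inv ha1).symm
  obtain ⟨Q, hQfin, hQnhds, hQsub, hQ⟩ := local_pl st hi hj hp
  rw [← ha'] at hQnhds
  exact ⟨Q, hQfin, hQnhds, hQsub, hQ⟩

/-- **The limit atlas is a PL atlas.** [folklore] -/
theorem isPLManifold_plCharted : @IsPLManifold n hcomp haff M _ (plCharted (n := n) (M := M)) := by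
  have hG : @HasGroupoid _ _ M _ (plCharted (n := n) (M := M)) (plGroupoid n hcomp haff) :=
    @HasGroupoid.mk _ _ M _ (plCharted (n := n) (M := M)) _ fun {e e'} he he' => by
      obtain ⟨i, rfl⟩ := he
      obtain ⟨j, rfl⟩ := he'
      rw [mem_plGroupoid_iff]
      refine ⟨isPLOn_transition i j, ?_⟩
      have ht : ((finalChart (n := n) (M := M) i).symm ≫ₕ finalChart (n := n) (M := M) j).target =
          ((finalChart (n := n) (M := M) i).symm ≫ₕ finalChart (n := n) (M := M) j).symm.source :=
        (OpenPartialHomeomorph.symm_source _).symm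
      rw [ht, OpenPartialHomeomorph.trans_symm_eq_symm_trans_symm, OpenPartialHomeomorph.symm_symm]
      exact isPLOn_transition j i
  exact @IsPLManifold.mk n hcomp haff M _ (plCharted (n := n) (M := M)) hG

/-- **The limit atlas is Whitehead compatible with the smooth atlas.** [folklore] -/
theorem isWhiteheadCompatible_plCharted : IsWhiteheadCompatible n M (plCharted (n := n) (M := M)) cDIFF := by
  rintro e ⟨i, rfl⟩ e' he'
  set st := (GS (n := n) (M := M) (kst (n := n) (M := M) i)).st with hst
  have hi := (GS (n := n) (M := M) (kst (n := n) (M := M) i)).inv i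
  intro a ha
  have hp : (chartOPH st hi).symm a ∈ st.W i ∩ e'.source := by
    rw [OpenPartialHomeomorph.trans_source] at ha
    exact ⟨(chartOPH st hi).map_target ha.1, ha.2⟩
  have ha' : a = st.φ i ((chartOPH st hi).symm a) := by
    have ha1 : a ∈ (chartOPH st hi).target := by rw [OpenPartialHomeomorph.trans_source] at ha; exact ha.1
    exact ((chartOPH st hi).right_inv ha1).symm
  obtain ⟨Q, hQfin, hQnhds, hQsub, hQ⟩ := local_pd st hi he' hp
  rw [← ha'] at hQnhds
  exact ⟨Q, hQfin, hQnhds, hQsub, hQ⟩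

/-- **Whitehead's triangulation theorem (existence), nonempty case.** [folklore] -/
theorem triangulation_of_nonempty :
    ∃ cPL : ChartedSpace (𝔼 n) M, @IsPLManifold n hcomp haff M _ cPL ∧ IsWhiteheadCompatible n M cPL cDIFF :=
  ⟨plCharted, isPLManifold_plCharted hcomp haff, isWhiteheadCompatible_plCharted⟩

end Assembly

/-! ### The theorem -/

section Theorem

variable (n : ℕ) (hcomp : IsPLOn.comp (n := n)) (haff : isPLOn_affineMap (n := n) (m := n))

/-- **Whitehead's triangulation theorem (existence)** — every Hausdorff second countable smooth
`n`-manifold admits a PL structure on the same space which is Whitehead compatible with its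
smooth atlas, i.e. a smooth triangulation. Munkres (1966), Theorem 10.6 (after J.H.C. Whitehead,
*On C¹-complexes*, 1940): the inductive construction of §10 — straightening of the imbedding near
each chart (Lemma 10.2, Cor. 10.3), extension over a box (Lemma 10.4), and the passage to the
limit over a locally finite cover — formalised in the `Whitehead*` files of this directory.
[cite: Munkres1966, Theorem 10.6] -/
theorem exists_isPLManifold_isWhiteheadCompatible_holds : exists_isPLManifold_isWhiteheadCompatible n hcomp haff := by
  intro M _ _ _ cDIFF _
  rcases isEmpty_or_nonempty M with hM | hM
  · exact triangulation_of_isEmpty hcomp haff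
  · exact triangulation_of_nonempty hcomp haff

end Theorem

end Literature.Topology.FourManifolds
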